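import Mathlib.LinearAlgebra.Basis.VectorSpace
import Mathlib.LinearAlgebra.FiniteDimensional.Lemmas
import Mathlib.LinearAlgebra.Matrix.ToLin
import Mathlib.Data.Finset.Sort
import Literature.Computability.QuantumComplexity.GaussianRank

/-!
# Crux `SpinorFlattening.NegApproxGaussRankSuperpoly` (stmt-QuantumAdvantage-1245) — stub `stub_normalOrder`

Line `spectral-mass-flattening`: CAR NORMAL ORDERING of one Gaussian state `g` along a complement of its
annihilator space (the algebraic heart of the normal-ordering deficiency of the Clifford flattening).
With `c(v) = Σ_p v_p c_p` (`c(v)c(w) + c(w)c(v) = 2B(v,w)·1`, `B(v,w) = Σ_p v_p w_p`, from the CAR), `L` the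
span of the `n` annihilator rows of `g` and `u` a basis of a linear complement `U` (`dim U = n`):
LOWERING — an annihilating `c(l)` maps `u`-words of length `k+1` on `g` into combinations of `u`-words of
length `≤ k`, parity `k`; hence every word `c(w_1)⋯c(w_K) g` is a combination of `u`-words of length `≤ K`,
parity `K`; SORTING — inserting `c(u_i)` into a sorted `u`-word costs only shorter words (`2B` per swap,
`c(u_i)² = B(u_i,u_i)`), so sorted repetition-free words, indexed by the subsets of `Fin n`, suffice.
Stated over functions `c`, `T` (unsorted filtration: `T j` = span of the `u`-words of length `≤ j`, parity
`j`, on `g`), `S` (sorted filtration: `S a m` = span of the SORTED `u`-words with letters `≥ a`, length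
`≤ m`, parity `m`, on `g`) pinned down by hypotheses `hc`, `hT`, `hS` (no auxiliary definitions). -/

noncomputable section

namespace Summit.QuantumAdvantage.QuantumAdvantage.Theorems.SpinorFlattening

open Matrix Finset
open Literature.Computability.QuantumComplexity Literature.Computability.Cryptography

section NormalOrder

variable {n : ℕ} (c : (Fin n × Bool → ℂ) → Matrix (QReg n) (QReg n) ℂ)
  (hc : ∀ v, c v = ∑ p : Fin n × Bool, v p • majorana n p.1 p.2)
  (g : QReg n → ℂ) (u : Fin n → (Fin n × Bool → ℂ))
  (T : ℕ → Submodule ℂ (QReg n → ℂ))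
  (hT : ∀ j, T j = Submodule.span ℂ {x : QReg n → ℂ | ∃ I : List (Fin n),
    I.length ≤ j ∧ I.length % 2 = j % 2 ∧ (I.map fun i => c (u i)).prod *ᵥ g = x})
  (S : ℕ → ℕ → Submodule ℂ (QReg n → ℂ))
  (hS : ∀ a m, S a m = Submodule.span ℂ {x : QReg n → ℂ | ∃ J : List (Fin n),
    J.Pairwise (· < ·) ∧ (∀ i ∈ J, a ≤ (i : ℕ)) ∧ J.length ≤ m ∧ J.length % 2 = m % 2 ∧
      (J.map fun i => c (u i)).prod *ᵥ g = x})

/-! ### Linearity of `c` and the canonical anticommutation relations -/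

include hc in
/-- `c` is additive. -/
theorem normalOrder_c_add (v w : Fin n × Bool → ℂ) : c (v + w) = c v + c w := by
  simp only [hc, Pi.add_apply, add_smul, Finset.sum_add_distrib]

include hc in
/-- `c` is homogeneous. -/
theorem normalOrder_c_smul (a : ℂ) (v : Fin n × Bool → ℂ) : c (a • v) = a • c v := by
  simp only [hc, Pi.smul_apply, smul_eq_mul, Finset.smul_sum, smul_smul]

include hc in
/-- `c` commutes with finite sums. -/
theorem normalOrder_c_sum {ι : Type*} (s : Finset ι) (f : ι → Fin n × Bool → ℂ) :
    c (∑ i ∈ s, f i) = ∑ i ∈ s, c (f i) := by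
  classical
  induction s using Finset.induction_on with
  | empty => simp only [Finset.sum_empty, hc, Pi.zero_apply, zero_smul, Finset.sum_const_zero]
  | insert a s ha ih => rw [Finset.sum_insert ha, Finset.sum_insert ha, normalOrder_c_add c hc, ih]

include hc in
/-- **CAR** for the combinations: `c(v) c(w) + c(w) c(v) = 2 B(v,w) · 1`, `B(v,w) = Σ_p v_p w_p`. -/
theorem normalOrder_car (v w : Fin n × Bool → ℂ) :
    c v * c w + c w * c v = (2 * ∑ p, v p * w p) • (1 : Matrix (QReg n) (QReg n) ℂ) := by
  have key : ∀ p q : Fin n × Bool,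
      (v p • majorana n p.1 p.2) * (w q • majorana n q.1 q.2) +
        (w q • majorana n q.1 q.2) * (v p • majorana n p.1 p.2) =
      (v p * w q) • (if p = q then (2 : ℂ) • (1 : Matrix (QReg n) (QReg n) ℂ) else 0) := by
    intro p q
    rw [← majorana_anticommutator p q, Matrix.smul_mul, Matrix.mul_smul, Matrix.smul_mul,
      Matrix.mul_smul, smul_smul, smul_smul, smul_add, mul_comm (w q) (v p)]
  rw [hc v, hc w, Finset.sum_mul_sum, Finset.sum_mul_sum, Finset.sum_comm (s := Finset.univ)
    (f := fun q p => (w q • majorana n q.1 q.2) * (v p • majorana n p.1 p.2)),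
    ← Finset.sum_add_distrib]
  simp_rw [← Finset.sum_add_distrib, key, smul_ite, smul_zero, Finset.sum_ite_eq, Finset.mem_univ,
    if_true, smul_smul, ← Finset.sum_smul, ← Finset.sum_mul, mul_comm _ (2 : ℂ)]

include hc in
/-- CAR on vectors: `c(v) c(w) x = − c(w) c(v) x + 2 B(v,w) x`. -/
theorem normalOrder_car_mulVec (v w : Fin n × Bool → ℂ) (x : QReg n → ℂ) :
    c v *ᵥ (c w *ᵥ x) = -(c w *ᵥ (c v *ᵥ x)) + (2 * ∑ p, v p * w p) • x := by
  have h := normalOrder_car c hc v w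
  rw [Matrix.mulVec_mulVec, Matrix.mulVec_mulVec, eq_neg_add_iff_add_eq, ← Matrix.add_mulVec,
    add_comm, h, Matrix.smul_mulVec, Matrix.one_mulVec]

include hc in
/-- Squares on vectors: `c(v) c(v) x = B(v,v) x`. -/
theorem normalOrder_sq_mulVec (v : Fin n × Bool → ℂ) (x : QReg n → ℂ) :
    c v *ᵥ (c v *ᵥ x) = (∑ p, v p * v p) • x := by
  have h := normalOrder_car_mulVec c hc v v x
  have h2 : (2 : ℂ) • (c v *ᵥ (c v *ᵥ x)) = (2 : ℂ) • ((∑ p, v p * v p) • x) := by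
    rw [two_smul, smul_smul]
    nth_rewrite 1 [h]
    abel
  exact smul_right_injective _ (two_ne_zero' ℂ) h2

/-- Unfolding the leftmost letter of a word acting on `g`. -/
theorem normalOrder_word_cons (i : Fin n) (I : List (Fin n)) :
    ((i :: I).map fun j => c (u j)).prod *ᵥ g = c (u i) *ᵥ ((I.map fun j => c (u j)).prod *ᵥ g) := by
  simp only [List.map_cons, List.prod_cons, Matrix.mulVec_mulVec]

/-! ### The unsorted filtration `T j` -/

include hT in
/-- A `u`-word of admissible length and parity applied to `g` lies in `T j`. -/
theorem normalOrder_word_mem_T {j : ℕ} (I : List (Fin n)) (h1 : I.length ≤ j)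
    (h2 : I.length % 2 = j % 2) : (I.map fun i => c (u i)).prod *ᵥ g ∈ T j := by
  rw [hT]
  exact Submodule.subset_span ⟨I, h1, h2, rfl⟩

include hT in
/-- Monotonicity of `T` in steps of two. -/
theorem normalOrder_T_mono {a b : ℕ} (hab : a ≤ b) (hpar : a % 2 = b % 2) : T a ≤ T b := by
  rw [hT, hT]
  exact Submodule.span_mono fun _ ⟨I, h1, h2, h3⟩ => ⟨I, h1.trans hab, h2.trans hpar, h3⟩

include hT in
/-- Left multiplication by a complement letter raises the filtration degree by one. -/
theorem normalOrder_T_raise (i : Fin n) (j : ℕ) {x : QReg n → ℂ} (hx : x ∈ T j) :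
    c (u i) *ᵥ x ∈ T (j + 1) := by
  have key : T j ≤ (T (j + 1)).comap (Matrix.mulVecLin (c (u i))) := by
    rw [hT j]
    refine Submodule.span_le.2 ?_
    rintro _ ⟨I, h1, h2, rfl⟩
    simp only [SetLike.mem_coe, Submodule.mem_comap, Matrix.mulVecLin_apply, ← normalOrder_word_cons]
    exact normalOrder_word_mem_T c g u T hT (i :: I) (by simp only [List.length_cons]; omega)
      (by simp only [List.length_cons]; omega)
  exact key hx

include hc hT in
/-- **LOWERING**: an annihilating combination `c(l)` (`c(l) g = 0`) applied to a `u`-word of length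
`k + 1` on `g` is a combination of `u`-words of length `≤ k` and parity `k` on `g`. -/
theorem normalOrder_lower (l : Fin n × Bool → ℂ) (hl : c l *ᵥ g = 0) :
    ∀ (I : List (Fin n)) (i₀ : Fin n),
      c l *ᵥ (c (u i₀) *ᵥ ((I.map fun i => c (u i)).prod *ᵥ g)) ∈ T I.length := by
  intro I
  induction I with
  | nil =>
    intro i₀
    rw [normalOrder_car_mulVec c hc]
    simp only [List.map_nil, List.prod_nil, Matrix.one_mulVec, hl, Matrix.mulVec_zero, neg_zero,
      zero_add, List.length_nil]
    exact Submodule.smul_mem _ _ (by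
      simpa only [List.map_nil, List.prod_nil, Matrix.one_mulVec] using
        normalOrder_word_mem_T c g u T hT (j := 0) [] (by simp) (by simp))
  | cons i₁ I' ih =>
    intro i₀
    rw [normalOrder_word_cons, normalOrder_car_mulVec c hc]
    refine Submodule.add_mem _ (Submodule.neg_mem _ ?_) (Submodule.smul_mem _ _ ?_)
    · simpa only [List.length_cons] using normalOrder_T_raise c g u T hT i₀ _ (ih i₁)
    · rw [← normalOrder_word_cons]
      exact normalOrder_word_mem_T c g u T hT (i₁ :: I') le_rfl rfl

include hc hT in
/-- LOWERING on the filtration: `c(l) T j ⊆ T (j+1)` for an annihilating `c(l)`. -/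
theorem normalOrder_T_lower (l : Fin n × Bool → ℂ) (hl : c l *ᵥ g = 0) (j : ℕ) {x : QReg n → ℂ}
    (hx : x ∈ T j) : c l *ᵥ x ∈ T (j + 1) := by
  have key : T j ≤ (T (j + 1)).comap (Matrix.mulVecLin (c l)) := by
    rw [hT j]
    refine Submodule.span_le.2 ?_
    rintro _ ⟨I, h1, h2, rfl⟩
    simp only [SetLike.mem_coe, Submodule.mem_comap, Matrix.mulVecLin_apply]
    cases I with
    | nil =>
      simp only [List.map_nil, List.prod_nil, Matrix.one_mulVec, hl]
      exact Submodule.zero_mem _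
    | cons i₀ I' =>
      rw [normalOrder_word_cons]
      simp only [List.length_cons] at h1 h2
      exact normalOrder_T_mono c g u T hT (by omega) (by omega)
        (normalOrder_lower c hc g u T hT l hl I' i₀)
  exact key hx

include hc hT in
/-- **Every word reduces to `u`-words**: if every coefficient vector splits as `w = l + Σ β_i u_i` with
`c(l) g = 0`, then `c(w_1) ⋯ c(w_K) g ∈ T K` for all `w_1, …, w_K`. -/
theorem normalOrder_words
    (hdec : ∀ w : Fin n × Bool → ℂ, ∃ (l : Fin n × Bool → ℂ) (β : Fin n → ℂ),
      c l *ᵥ g = 0 ∧ w = l + ∑ i, β i • u i) :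
    ∀ ws : List (Fin n × Bool → ℂ), (ws.map c).prod *ᵥ g ∈ T ws.length := by
  intro ws
  induction ws with
  | nil =>
    simpa only [List.map_nil, List.prod_nil, Matrix.one_mulVec, List.length_nil] using
      normalOrder_word_mem_T c g u T hT (j := 0) [] (by simp) (by simp)
  | cons w ws ih =>
    obtain ⟨l, β, hl, rfl⟩ := hdec w
    simp only [List.map_cons, List.prod_cons, ← Matrix.mulVec_mulVec, List.length_cons]
    rw [normalOrder_c_add c hc, normalOrder_c_sum c hc, Matrix.add_mulVec, Matrix.sum_mulVec]
    refine Submodule.add_mem _ (normalOrder_T_lower c hc g u T hT l hl _ ih)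
      (Submodule.sum_mem _ fun i _ => ?_)
    rw [normalOrder_c_smul c hc, Matrix.smul_mulVec]
    exact Submodule.smul_mem _ _ (normalOrder_T_raise c g u T hT i _ ih)

/-! ### The sorted filtration `S a m` -/

include hS in
/-- A sorted `u`-word with admissible letters, length and parity applied to `g` lies in `S a m`. -/
theorem normalOrder_sorted_mem_S {a m : ℕ} (J : List (Fin n)) (h1 : J.Pairwise (· < ·))
    (h2 : ∀ i ∈ J, a ≤ (i : ℕ)) (h3 : J.length ≤ m) (h4 : J.length % 2 = m % 2) :
    (J.map fun i => c (u i)).prod *ᵥ g ∈ S a m := by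
  rw [hS]
  exact Submodule.subset_span ⟨J, h1, h2, h3, h4, rfl⟩

include hS in
/-- Monotonicity of `S`: weaken the letter bound, raise the length bound by an even amount. -/
theorem normalOrder_S_mono {a a' m m' : ℕ} (ha : a' ≤ a) (hm : m ≤ m') (hpar : m % 2 = m' % 2) :
    S a m ≤ S a' m' := by
  rw [hS, hS]
  exact Submodule.span_mono fun _ ⟨J, h1, h2, h3, h4, h5⟩ =>
    ⟨J, h1, fun i hi => ha.trans (h2 i hi), h3.trans hm, h4.trans hpar, h5⟩

include hS in
/-- PREPENDING a small letter: `c(u_{i₁}) S (i₁ + 1) m ⊆ S a (m + 1)` for `a ≤ i₁`. -/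
theorem normalOrder_S_prepend (i₁ : Fin n) {a : ℕ} (ha : a ≤ (i₁ : ℕ)) (m : ℕ) {x : QReg n → ℂ}
    (hx : x ∈ S ((i₁ : ℕ) + 1) m) : c (u i₁) *ᵥ x ∈ S a (m + 1) := by
  have key : S ((i₁ : ℕ) + 1) m ≤ (S a (m + 1)).comap (Matrix.mulVecLin (c (u i₁))) := by
    rw [hS ((i₁ : ℕ) + 1)]
    refine Submodule.span_le.2 ?_
    rintro _ ⟨J, h1, h2, h3, h4, rfl⟩
    simp only [SetLike.mem_coe, Submodule.mem_comap, Matrix.mulVecLin_apply, ← normalOrder_word_cons]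
    refine normalOrder_sorted_mem_S c g u S hS (i₁ :: J) ?_ ?_
      (by simp only [List.length_cons]; omega) (by simp only [List.length_cons]; omega)
    · rw [List.pairwise_cons]
      refine ⟨fun j hj => ?_, h1⟩
      have := h2 j hj
      exact Fin.lt_def.2 (by omega)
    · intro i hi
      rcases List.mem_cons.1 hi with rfl | hi
      · exact ha
      · have := h2 i hi
        omega
  exact key hx

include hc hS in
/-- **INSERTION**: `c(u_i)` times a SORTED `u`-word of length `k` (letters `≥ a`, `i ≥ a`) applied to
`g` is a combination of sorted `u`-words of length `≤ k + 1` and parity `k + 1` with letters `≥ a`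
(a swap costs `2B` times a shorter word, a repeated letter squares to the scalar `B(u_i,u_i)`). -/
theorem normalOrder_insert (i : Fin n) :
    ∀ (I : List (Fin n)) (a : ℕ), I.Pairwise (· < ·) → (∀ j ∈ I, a ≤ (j : ℕ)) → a ≤ (i : ℕ) →
      c (u i) *ᵥ ((I.map fun j => c (u j)).prod *ᵥ g) ∈ S a (I.length + 1) := by
  intro I
  induction I with
  | nil =>
    intro a _ _ hi
    have hw : c (u i) *ᵥ ((([] : List (Fin n)).map fun j => c (u j)).prod *ᵥ g) =
        (([i].map fun j => c (u j)).prod *ᵥ g) := by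
      simp only [List.map_nil, List.prod_nil, Matrix.one_mulVec, List.map_cons, List.prod_cons, mul_one]
    rw [hw]
    exact normalOrder_sorted_mem_S c g u S hS [i] (List.pairwise_singleton _ _)
      (fun j hj => by rw [List.mem_singleton.1 hj]; exact hi) (by simp) (by simp)
  | cons i₁ I' ih =>
    intro a hsort hbound hi
    obtain ⟨hlt, hsort'⟩ := List.pairwise_cons.1 hsort
    have ha₁ : a ≤ (i₁ : ℕ) := hbound i₁ (List.mem_cons_self)
    have hbound' : ∀ j ∈ I', (i₁ : ℕ) + 1 ≤ (j : ℕ) := fun j hj =>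
      Nat.succ_le_of_lt (Fin.lt_def.1 (hlt j hj))
    -- the tail word is admissible
    have htail : (I'.map fun j => c (u j)).prod *ᵥ g ∈ S a (I'.length + 2) :=
      normalOrder_sorted_mem_S c g u S hS I' hsort' (fun j hj => by have := hbound' j hj; omega)
        (by omega) (by omega)
    rw [normalOrder_word_cons]
    rcases lt_trichotomy i i₁ with h | rfl | h
    · -- `i < i₁`: the word `i :: i₁ :: I'` is already sorted
      rw [← normalOrder_word_cons, ← normalOrder_word_cons]
      refine normalOrder_sorted_mem_S c g u S hS (i :: i₁ :: I') ?_ ?_ (by simp) (by simp)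
      · rw [List.pairwise_cons]
        refine ⟨fun j hj => ?_, hsort⟩
        rcases List.mem_cons.1 hj with rfl | hj
        · exact h
        · exact h.trans (hlt j hj)
      · intro j hj
        rcases List.mem_cons.1 hj with rfl | hj
        · exact hi
        · exact hbound j hj
    · -- `i = i₁`: the repeated letter squares to a scalar
      rw [normalOrder_sq_mulVec c hc]
      simpa only [List.length_cons] using Submodule.smul_mem _ _ htail
    · -- `i₁ < i`: swap (CAR), insert `i` into the tail by induction, prepend `i₁`
      rw [normalOrder_car_mulVec c hc]
      simp only [List.length_cons]
      refine Submodule.add_mem _ (Submodule.neg_mem _ ?_) (Submodule.smul_mem _ _ htail)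
      have hins := ih ((i₁ : ℕ) + 1) hsort' hbound' (Nat.succ_le_of_lt (Fin.lt_def.1 h))
      exact normalOrder_S_prepend c g u S hS i₁ ha₁ _ hins

include hc hS in
/-- Left multiplication by a complement letter on the sorted filtration: `c(u_i) S 0 m ⊆ S 0 (m+1)`. -/
theorem normalOrder_S_raise (i : Fin n) (m : ℕ) {x : QReg n → ℂ} (hx : x ∈ S 0 m) :
    c (u i) *ᵥ x ∈ S 0 (m + 1) := by
  have key : S 0 m ≤ (S 0 (m + 1)).comap (Matrix.mulVecLin (c (u i))) := by
    rw [hS 0 m]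
    refine Submodule.span_le.2 ?_
    rintro _ ⟨J, h1, h2, h3, h4, rfl⟩
    simp only [SetLike.mem_coe, Submodule.mem_comap, Matrix.mulVecLin_apply]
    exact normalOrder_S_mono c g u S hS le_rfl (by omega) (by omega)
      (normalOrder_insert c hc g u S hS i J 0 h1 h2 (Nat.zero_le _))
  exact key hx

include hc hT hS in
/-- **SORTING**: every `u`-word applied to `g` is a combination of sorted ones: `T K ⊆ S 0 K`. -/
theorem normalOrder_T_le_S (K : ℕ) : T K ≤ S 0 K := by
  have key : ∀ I : List (Fin n), (I.map fun i => c (u i)).prod *ᵥ g ∈ S 0 I.length := by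
    intro I
    induction I with
    | nil =>
      exact normalOrder_sorted_mem_S c g u S hS (a := 0) (m := 0) [] List.Pairwise.nil (by simp)
        (by simp) (by simp)
    | cons i I' ih =>
      rw [normalOrder_word_cons]
      simpa only [List.length_cons] using normalOrder_S_raise c hc g u S hS i _ ih
  rw [hT]
  refine Submodule.span_le.2 ?_
  rintro _ ⟨I, h1, h2, rfl⟩
  exact normalOrder_S_mono c g u S hS le_rfl h1 h2 (key I)

include hc hS in
/-- The sorted words are indexed by the finite subsets of `Fin n`: `S 0 K` is contained in the span of
the words over `I.sort (· ≤ ·)`, `I ⊆ Fin n`, `|I| ≤ K`, `|I| ≡ K (mod 2)` (the target of the stub). -/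
theorem normalOrder_S_le_range (K : ℕ) : S 0 K ≤
    Submodule.span ℂ (Set.range fun I : {I : Finset (Fin n) // I.card ≤ K ∧ I.card % 2 = K % 2} =>
      ((I.1.sort (· ≤ ·)).map fun i => ∑ p : Fin n × Bool, u i p • majorana n p.1 p.2).prod *ᵥ g) := by
  classical
  rw [hS]
  refine Submodule.span_le.2 ?_
  rintro _ ⟨J, h1, -, h3, h4, rfl⟩
  have hnd : J.Nodup := h1.imp ne_of_lt
  have hsort : J.toFinset.sort (· ≤ ·) = J := (List.toFinset_sort (· ≤ ·) hnd).2 (h1.imp le_of_lt)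
  have hcard : J.toFinset.card = J.length := List.toFinset_card_of_nodup hnd
  refine Submodule.subset_span ⟨⟨J.toFinset, by omega, by omega⟩, ?_⟩
  simp only [hsort, hc]

/-! ### A complement of the annihilator space -/

include hc in
/-- **Complement**: a Gaussian state `g` on `n` qubits admits `n` coefficient vectors `u_0, …, u_{n-1}`
such that every `w ∈ ℂ^{2n}` splits as `w = l + Σ β_i u_i` with `c(l) g = 0` (take a basis of a linear
complement of the `n`-dimensional span of the annihilator rows inside the `2n`-dimensional coefficient
space). -/
theorem normalOrder_complement (hg : IsGaussian g) :
    ∃ u : Fin n → (Fin n × Bool → ℂ), ∀ w : Fin n × Bool → ℂ,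
      ∃ (l : Fin n × Bool → ℂ) (β : Fin n → ℂ), c l *ᵥ g = 0 ∧ w = l + ∑ i, β i • u i := by
  obtain ⟨-, A, hA, hann⟩ := hg
  let L : Submodule ℂ (Fin n × Bool → ℂ) := Submodule.span ℂ (Set.range A)
  obtain ⟨U, hLU⟩ := L.exists_isCompl
  have hU : Module.finrank ℂ U = n := by
    have h := Submodule.finrank_sup_add_finrank_inf_eq L U
    rw [hLU.sup_eq_top, hLU.inf_eq_bot, finrank_top, finrank_bot, Module.finrank_pi,
      Fintype.card_prod, Fintype.card_fin, Fintype.card_bool, finrank_span_eq_card hA,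
      Fintype.card_fin] at h
    omega
  let b := Module.finBasisOfFinrankEq ℂ U hU
  refine ⟨fun i => (b i : Fin n × Bool → ℂ), fun w => ?_⟩
  obtain ⟨l, hl, v, hv, rfl⟩ := Submodule.mem_sup.1 (hLU.sup_eq_top ▸ Submodule.mem_top : w ∈ L ⊔ U)
  refine ⟨l, fun i => b.repr ⟨v, hv⟩ i, ?_, ?_⟩
  · -- `c(l) g = 0` for `l` in the span of the annihilator rows
    obtain ⟨α, rfl⟩ := (Submodule.mem_span_range_iff_exists_fun ℂ).1 hl
    rw [normalOrder_c_sum c hc, Matrix.sum_mulVec]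
    refine Finset.sum_eq_zero fun k _ => ?_
    rw [normalOrder_c_smul c hc, Matrix.smul_mulVec, hc (A k), hann k, smul_zero]
  · have h' := congrArg (fun x : U => (x : Fin n × Bool → ℂ)) (b.sum_repr ⟨v, hv⟩)
    simp only [Submodule.coe_sum, Submodule.coe_smul] at h'
    rw [h']

end NormalOrder

/-- **stub_normalOrder** — CAR NORMAL ORDERING along a complement of the annihilator space: for a Gaussian
state `g` on `n` qubits there are `n` Majorana combinations `c(u_0), …, c(u_{n-1})` (`c(u) = Σ_p u p • c_p`)
such that EVERY word `c_{p_1} ⋯ c_{p_K} g` of `K` Jordan–Wigner Majoranas (ordered product, repetitions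
allowed) lies in the span of the SORTED words `c(u_{i_1}) ⋯ c(u_{i_j}) g`, `i_1 < ⋯ < i_j`, over the subsets
`I ⊆ Fin n` with `|I| ≤ K`, `|I| ≡ K (mod 2)` (`u` = basis of a complement of the annihilator row space). -/
theorem stub_normalOrder :
    ∀ (n K : ℕ) (g : QReg n → ℂ), IsGaussian g →
      ∃ u : Fin n → (Fin n × Bool → ℂ),
        ∀ l : List (Fin n × Bool), l.length = K →
          (l.map fun p => majorana n p.1 p.2).prod *ᵥ g ∈
            Submodule.span ℂ (Set.range fun I : {I : Finset (Fin n) // I.card ≤ K ∧ I.card % 2 = K % 2} =>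
              ((I.1.sort (· ≤ ·)).map fun i => ∑ p : Fin n × Bool, u i p • majorana n p.1 p.2).prod *ᵥ g) := by
  intro n K g hg
  classical
  obtain ⟨u, hdec⟩ := normalOrder_complement (fun v => ∑ p : Fin n × Bool, v p • majorana n p.1 p.2)
    (fun _ => rfl) g hg
  refine ⟨u, fun l hl => ?_⟩
  have hw : (l.map fun p => majorana n p.1 p.2) =
      (l.map fun p => (Pi.single p (1 : ℂ) : Fin n × Bool → ℂ)).map
        (fun v => ∑ p : Fin n × Bool, v p • majorana n p.1 p.2) := by
    rw [List.map_map]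
    exact List.map_congr_left fun p _ => by simp [Pi.single_apply, Finset.sum_ite_eq']
  have hmem := normalOrder_words (fun v => ∑ p : Fin n × Bool, v p • majorana n p.1 p.2) (fun _ => rfl)
    g u _ (fun _ => rfl) hdec (l.map fun p => (Pi.single p (1 : ℂ) : Fin n × Bool → ℂ))
  rw [List.length_map, hl, ← hw] at hmem
  exact normalOrder_S_le_range _ (fun _ => rfl) g u _ (fun _ _ => rfl) K
    (normalOrder_T_le_S _ (fun _ => rfl) g u _ (fun _ => rfl) _ (fun _ _ => rfl) K hmem)

end Summit.QuantumAdvantage.QuantumAdvantage.Theorems.SpinorFlattening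

end
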